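import Mathlib
import Summits.MatrixMultiplication.MatrixMultiplication.Theses.AbelianSTPPCensus
import Summits.MatrixMultiplication.MatrixMultiplication.Theorems.AbelianSTPPCensusTEResiduals

/-!
# Route `AbelianSTPPCensus`, item `TEResidualSmall` (stmt-MatrixMultiplication-19760) — closed by the mm-stpp theory seat's theorem

The route item `Summit.MatrixMultiplication.MatrixMultiplication.Theses.AbelianSTPPCensus.TEResidualSmall` (cell mm-stpp, rung F-M1, D-0059;
route born 2026-08-25T22:13Z) is, verbatim, the statement proved in the tree as `Summit.MatrixMultiplication.MatrixMultiplication.Theorems.AbelianTECensus.teResidualSmall`;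
this file restates it at the route decl.

WHAT THIS IS NOT: no `ω` statement; the rung leaf still hinges on the open crux `ShapeExclusionTE`.
-/

-- single-conjunct summit: the mandated namespace repeats `MatrixMultiplication`.
set_option linter.dupNamespace false

namespace Summit.MatrixMultiplication.MatrixMultiplication.Theorems

/-- Route item `TEResidualSmall` of `AbelianSTPPCensus` holds (by `teResidualSmall`). [original] -/
theorem TEResidualSmall_proof : Summit.MatrixMultiplication.MatrixMultiplication.Theses.AbelianSTPPCensus.TEResidualSmall := by
  unfold Summit.MatrixMultiplication.MatrixMultiplication.Theses.AbelianSTPPCensus.TEResidualSmall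
  exact Summit.MatrixMultiplication.MatrixMultiplication.Theorems.AbelianTECensus.teResidualSmall

end Summit.MatrixMultiplication.MatrixMultiplication.Theorems
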